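import Mathlib
import Summits.Ventures.PercRepro2.CutFarOA3Theorem

/-!
# The UNCROSSED class: row 2′TRI is pointwise when the marks cannot be split between the roots
(blind cell PercRepro2, p3 g3, 2026-08-25; `proofs/P3-BRIDGE.md` §11.16)

A copy-state is CROSSED when `a₁ ↮ a₂` while one of the marks `o, b, a₃` reaches `a₁` and another
reaches `a₂`.  The pointwise census of the typed kernel (§11.14–§11.15) shows that EVERY negative
entry of the six-fold copy-symmetrised kernel on valid state triples involves a crossed state (500
negative unordered triples, each with ≥ 1 crossed state).  Hence on UNCROSSED instances — no
configuration below `z ∪ F` is crossed — the symmetrised kernel is pointwise nonnegative on the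
23 uncrossed valid states (`symK_nonneg_uncrossed`, `decide +kernel` over the `23³` triples; the
unsymmetrised kernel is not), and since `6 · typedCount` is the count of the symmetrised kernel
(`six_mul_typedCount`), **every typed base of an uncrossed instance is nonnegative**
(`typedCount_nonneg_of_uncrossed`).  The class contains the instances in which `{o, b, a₃}` sit
in one pocket behind a cut vertex, in which a root is reachable only through the other root, and
more generally every instance without two vertex-disjoint paths from distinct marks to the two
roots; the count is not identically zero on it (26 / 2789 random uncrossed instances nonzero).
Own work; standard axioms.
-/

namespace Summit.Ventures.PercRepro2

open UnionCluster

namespace CovForm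

namespace RootBridge

open OneTyped TypedA3 Untouched TypedFactor Separated

section Uncrossed

open Classical

/-- A state is UNCROSSED: `a₁ ↔ a₂`, or no mark reaches `a₁` while another reaches `a₂`. -/
def UncrossedSt (s : St) : Bool :=
  s.q' || !((s.Lo || s.Lb || s.L3) && (s.Ho || s.Hb || s.H3))

/-- Validity of a state: when `a₁ ↔ a₂`, each mark sees both roots or neither. -/
def ValidSt (s : St) : Bool :=
  (!s.q' || (s.Lo == s.Ho)) && (!s.q' || (s.Lb == s.Hb)) && (!s.q' || (s.L3 == s.H3))

/-- The six-fold symmetrisation of the kernel over the three copies. -/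
def symK (x y w : St) : ℤ :=
  KB x y w + KB x w y + KB y x w + KB y w x + KB w x y + KB w y x

/-- The 23 uncrossed valid states. -/
def uncrossedStates : List St :=
  [(false, false, false, false, false, false, false),
    (false, false, false, false, false, false, true),
    (false, false, false, false, false, true, false),
    (false, false, false, false, true, false, false),
    (false, false, false, false, true, false, true),
    (false, false, false, true, false, false, false),
    (false, false, false, true, false, true, false),
    (false, false, true, false, false, false, false),
    (false, false, true, false, false, false, true),
    (false, false, true, false, true, false, false),
    (false, false, true, false, true, false, true),
    (false, true, false, false, false, false, false),
    (false, true, false, false, false, true, false),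
    (false, true, false, true, false, false, false),
    (false, true, false, true, false, true, false),
    (true, false, false, false, false, false, false),
    (true, false, false, false, false, true, true),
    (true, false, false, true, true, false, false),
    (true, false, false, true, true, true, true),
    (true, true, true, false, false, false, false),
    (true, true, true, false, false, true, true),
    (true, true, true, true, true, false, false),
    (true, true, true, true, true, true, true)]

/-- Every uncrossed valid state is one of the 23. -/
theorem mem_uncrossedStates (a b c d e f g : Bool) (hu : UncrossedSt (a, b, c, d, e, f, g) = true)
    (hv : ValidSt (a, b, c, d, e, f, g) = true) : (a, b, c, d, e, f, g) ∈ uncrossedStates := by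
  revert a b c d e f g
  decide +kernel

/-- The symmetrised kernel is nonnegative on every triple of the 23 states (Boolean form). -/
theorem symK_nonneg_all :
    (uncrossedStates.all fun x => uncrossedStates.all fun y => uncrossedStates.all fun w =>
      decide (0 ≤ symK x y w)) = true := by
  decide +kernel

/-- The symmetrised kernel is nonnegative on every triple of the 23 states. -/
theorem symK_nonneg_list :
    ∀ x ∈ uncrossedStates, ∀ y ∈ uncrossedStates, ∀ w ∈ uncrossedStates, 0 ≤ symK x y w := by
  have h := symK_nonneg_all
  simp only [List.all_eq_true, decide_eq_true_eq] at h
  exact h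

/-- **The symmetrised kernel is pointwise nonnegative on uncrossed valid state triples.** -/
theorem symK_nonneg_uncrossed (x y w : St) (hx : UncrossedSt x = true) (hx' : ValidSt x = true)
    (hy : UncrossedSt y = true) (hy' : ValidSt y = true) (hw : UncrossedSt w = true)
    (hw' : ValidSt w = true) : 0 ≤ symK x y w := by
  obtain ⟨a1, b1, c1, d1, e1, f1, g1⟩ := x
  obtain ⟨a2, b2, c2, d2, e2, f2, g2⟩ := y
  obtain ⟨a3, b3, c3, d3, e3, f3, g3⟩ := w
  exact symK_nonneg_list _ (mem_uncrossedStates _ _ _ _ _ _ _ hx hx') _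
    (mem_uncrossedStates _ _ _ _ _ _ _ hy hy') _ (mem_uncrossedStates _ _ _ _ _ _ _ hw hw')

variable {V : Type*} {E : Type*} [Fintype E] [DecidableEq E] {R : Type*} [Field R]
  [LinearOrder R] [IsStrictOrderedRing R]
variable (ends : E → Sym2 V) (o a₁ a₂ a₃ b : V)

/-- A configuration is CROSSED: `a₁ ↮ a₂` while a mark reaches `a₁` and a mark reaches `a₂`. -/
structure CrossedConf (x : Config E) : Prop where
  notQ : ¬ Conn ends x a₂ a₁
  atA1 : Conn ends x a₁ o ∨ Conn ends x a₁ b ∨ Conn ends x a₁ a₃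
  atA2 : Conn ends x a₂ o ∨ Conn ends x a₂ b ∨ Conn ends x a₂ a₃

/-- An instance is UNCROSSED: no configuration below `z ∪ F` is crossed. -/
structure UncrossedInst (F : Finset E) (z : Config E) : Prop where
  not_crossed : ∀ x : Config E, x ≤ zF F z → ¬ CrossedConf ends o a₁ a₂ a₃ b x

omit [Fintype E] [DecidableEq E] in
/-- The state of a configuration that is not crossed is uncrossed. -/
lemma uncrossedSt_st {x : Config E} (h : ¬ CrossedConf ends o a₁ a₂ a₃ b x) :
    UncrossedSt (st ends o a₁ a₂ a₃ b x) = true := by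
  unfold UncrossedSt st St.q' St.Lo St.Ho St.Lb St.Hb St.L3 St.H3
  by_cases hq : Conn ends x a₂ a₁
  · simp [hq]
  · have h' : ¬ ((Conn ends x a₁ o ∨ Conn ends x a₁ b ∨ Conn ends x a₁ a₃) ∧
        (Conn ends x a₂ o ∨ Conn ends x a₂ b ∨ Conn ends x a₂ a₃)) :=
      fun hc => h ⟨hq, hc.1, hc.2⟩
    simp only [hq, decide_false, Bool.false_or, Bool.not_eq_true', Bool.and_eq_false_iff,
      Bool.or_eq_false_iff, decide_eq_false_iff_not]
    tauto

omit [Fintype E] [DecidableEq E] in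
/-- The state of a configuration is valid: transitivity of the connection relation. -/
lemma validSt_st (x : Config E) : ValidSt (st ends o a₁ a₂ a₃ b x) = true := by
  unfold ValidSt st St.q' St.Lo St.Ho St.Lb St.Hb St.L3 St.H3
  by_cases hq : Conn ends x a₂ a₁
  · have h1 : Conn ends x a₁ o ↔ Conn ends x a₂ o :=
      ⟨fun h => conn_trans hq h, fun h => conn_trans (conn_symm hq) h⟩
    have h2 : Conn ends x a₁ b ↔ Conn ends x a₂ b :=
      ⟨fun h => conn_trans hq h, fun h => conn_trans (conn_symm hq) h⟩
    have h3 : Conn ends x a₁ a₃ ↔ Conn ends x a₂ a₃ :=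
      ⟨fun h => conn_trans hq h, fun h => conn_trans (conn_symm hq) h⟩
    simp only [hq, decide_true, Bool.not_true, Bool.false_or, Bool.and_eq_true, beq_iff_eq,
      decide_eq_decide]
    exact ⟨⟨h1, h2⟩, h3⟩
  · simp [hq]

/-- A typed count of a kernel nonnegative on the support of the count is nonnegative. -/
lemma typedCount_nonneg_of_nonneg_on' (F : Finset E) (z : Config E) (τ : E → ℕ)
    {K : Config E → Config E → Config E → R}
    (hK : ∀ x y w, (∀ e, e ∉ F → x e = z e) → (∀ e, e ∉ F → y e = z e) →
      (∀ e, e ∉ F → w e = z e) → 0 ≤ K x y w) :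
    0 ≤ typedCount F z τ K := by
  unfold typedCount
  refine Finset.sum_nonneg fun x _ => Finset.sum_nonneg fun y _ => Finset.sum_nonneg fun w _ => ?_
  split_ifs with h
  · exact hK x y w (fun e he => (h.1 e he).1) (fun e he => (h.1 e he).2.1)
      (fun e he => (h.1 e he).2.2)
  · exact le_refl _

/-- **Row 2′TRI on every uncrossed instance**: if no configuration below `z ∪ F` has `a₁ ↮ a₂`
with one mark at `a₁` and another at `a₂`, every typed base of the crux kernel is nonnegative. -/
theorem typedCount_nonneg_of_uncrossed (F : Finset E) (z : Config E) (τ : E → ℕ)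
    (hτ : ∀ e ∈ F, τ e = 1 ∨ τ e = 2) (hU : UncrossedInst ends o a₁ a₂ a₃ b F z) :
    0 ≤ typedCount F z τ (K3 ends o a₁ a₂ a₃ b : Config E → Config E → Config E → R) := by
  have h6 := six_mul_typedCount F z τ hτ (K3 ends o a₁ a₂ a₃ b : Config E → Config E → Config E → R)
  have hK : (0 : R) ≤ typedCount F z τ (fun x y w =>
      ((symK (st ends o a₁ a₂ a₃ b x) (st ends o a₁ a₂ a₃ b y) (st ends o a₁ a₂ a₃ b w) : ℤ) : R)) := by
    refine typedCount_nonneg_of_nonneg_on' F z τ fun x y w hx hy hw => ?_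
    have ux := uncrossedSt_st ends o a₁ a₂ a₃ b (hU.not_crossed x (le_zF hx))
    have uy := uncrossedSt_st ends o a₁ a₂ a₃ b (hU.not_crossed y (le_zF hy))
    have uw := uncrossedSt_st ends o a₁ a₂ a₃ b (hU.not_crossed w (le_zF hw))
    exact_mod_cast symK_nonneg_uncrossed _ _ _ ux (validSt_st ends o a₁ a₂ a₃ b x) uy
      (validSt_st ends o a₁ a₂ a₃ b y) uw (validSt_st ends o a₁ a₂ a₃ b w)
  have hsym : typedCount F z τ (fun x y w =>
      ((symK (st ends o a₁ a₂ a₃ b x) (st ends o a₁ a₂ a₃ b y) (st ends o a₁ a₂ a₃ b w) : ℤ) : R)) =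
      typedCount F z τ (fun x y w =>
        (K3 ends o a₁ a₂ a₃ b x y w : R) + K3 ends o a₁ a₂ a₃ b x w y + K3 ends o a₁ a₂ a₃ b y x w +
          K3 ends o a₁ a₂ a₃ b y w x + K3 ends o a₁ a₂ a₃ b w x y + K3 ends o a₁ a₂ a₃ b w y x) := by
    refine typedCount_congr' _ _ _ _ _ fun x y w => ?_
    simp only [K3_eq_KB]
    unfold symK
    push_cast
    ring
  have h6' : (0 : R) ≤ 6 * typedCount F z τ (K3 ends o a₁ a₂ a₃ b : Config E → Config E → Config E → R) := by
    rw [h6, ← hsym]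
    exact hK
  exact (mul_nonneg_iff_of_pos_left (by norm_num : (0 : R) < 6)).mp h6'

end Uncrossed

section Sharpened

open Classical

/-- A state is MILDLY crossed: uncrossed, or the harmless crossing «`o` and `b` at one root, `a₃`
alone at the other» (the only crossed states absent from every negative triple of the kernel). -/
def MildSt (s : St) : Bool :=
  UncrossedSt s || (!s.q' && s.Ho && s.Hb && s.L3 && !s.Lo && !s.Lb && !s.H3) ||
    (!s.q' && s.Lo && s.Lb && s.H3 && !s.Ho && !s.Hb && !s.L3)

/-- The 25 mild valid states. -/
def mildStates : List St :=
  [(false, false, false, false, false, false, false),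
    (false, false, false, false, false, false, true),
    (false, false, false, false, false, true, false),
    (false, false, false, false, true, false, false),
    (false, false, false, false, true, false, true),
    (false, false, false, true, false, false, false),
    (false, false, false, true, false, true, false),
    (false, false, true, false, false, false, false),
    (false, false, true, false, false, false, true),
    (false, false, true, false, true, false, false),
    (false, false, true, false, true, false, true),
    (false, false, true, false, true, true, false),
    (false, true, false, false, false, false, false),
    (false, true, false, false, false, true, false),
    (false, true, false, true, false, false, false),
    (false, true, false, true, false, false, true),
    (false, true, false, true, false, true, false),
    (true, false, false, false, false, false, false),
    (true, false, false, false, false, true, true),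
    (true, false, false, true, true, false, false),
    (true, false, false, true, true, true, true),
    (true, true, true, false, false, false, false),
    (true, true, true, false, false, true, true),
    (true, true, true, true, true, false, false),
    (true, true, true, true, true, true, true)]

/-- Every mild valid state is one of the 25. -/
theorem mem_mildStates (a b c d e f g : Bool) (hu : MildSt (a, b, c, d, e, f, g) = true)
    (hv : ValidSt (a, b, c, d, e, f, g) = true) : (a, b, c, d, e, f, g) ∈ mildStates := by
  revert a b c d e f g
  decide +kernel

/-- The symmetrised kernel is nonnegative on every triple of the 25 states (Boolean form). -/
theorem symK_nonneg_all_mild :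
    (mildStates.all fun x => mildStates.all fun y => mildStates.all fun w =>
      decide (0 ≤ symK x y w)) = true := by
  decide +kernel

/-- **The symmetrised kernel is pointwise nonnegative on mild valid state triples.** -/
theorem symK_nonneg_mild (x y w : St) (hx : MildSt x = true) (hx' : ValidSt x = true)
    (hy : MildSt y = true) (hy' : ValidSt y = true) (hw : MildSt w = true)
    (hw' : ValidSt w = true) : 0 ≤ symK x y w := by
  have h := symK_nonneg_all_mild
  simp only [List.all_eq_true, decide_eq_true_eq] at h
  obtain ⟨a1, b1, c1, d1, e1, f1, g1⟩ := x
  obtain ⟨a2, b2, c2, d2, e2, f2, g2⟩ := y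
  obtain ⟨a3, b3, c3, d3, e3, f3, g3⟩ := w
  exact h _ (mem_mildStates _ _ _ _ _ _ _ hx hx') _ (mem_mildStates _ _ _ _ _ _ _ hy hy') _
    (mem_mildStates _ _ _ _ _ _ _ hw hw')

variable {V : Type*} {E : Type*} [Fintype E] [DecidableEq E] {R : Type*} [Field R]
  [LinearOrder R] [IsStrictOrderedRing R]
variable (ends : E → Sym2 V) (o a₁ a₂ a₃ b : V)

/-- A configuration is BADLY crossed: crossed, and not of the harmless form «`o, b` at one root,
`a₃` alone at the other». -/
structure BadlyCrossedConf (x : Config E) : Prop where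
  crossed : CrossedConf ends o a₁ a₂ a₃ b x
  notHarmless1 : ¬ (Conn ends x a₂ o ∧ Conn ends x a₂ b ∧ Conn ends x a₁ a₃ ∧ ¬ Conn ends x a₁ o ∧
    ¬ Conn ends x a₁ b ∧ ¬ Conn ends x a₂ a₃)
  notHarmless2 : ¬ (Conn ends x a₁ o ∧ Conn ends x a₁ b ∧ Conn ends x a₂ a₃ ∧ ¬ Conn ends x a₂ o ∧
    ¬ Conn ends x a₂ b ∧ ¬ Conn ends x a₁ a₃)

/-- An instance is MILD: no configuration below `z ∪ F` is badly crossed. -/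
structure MildInst (F : Finset E) (z : Config E) : Prop where
  not_bad : ∀ x : Config E, x ≤ zF F z → ¬ BadlyCrossedConf ends o a₁ a₂ a₃ b x

omit [Fintype E] [DecidableEq E] in
/-- The state of a configuration that is not badly crossed is mild. -/
lemma mildSt_st {x : Config E} (h : ¬ BadlyCrossedConf ends o a₁ a₂ a₃ b x) :
    MildSt (st ends o a₁ a₂ a₃ b x) = true := by
  by_cases hc : CrossedConf ends o a₁ a₂ a₃ b x
  · have h' : (Conn ends x a₂ o ∧ Conn ends x a₂ b ∧ Conn ends x a₁ a₃ ∧ ¬ Conn ends x a₁ o ∧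
        ¬ Conn ends x a₁ b ∧ ¬ Conn ends x a₂ a₃) ∨ (Conn ends x a₁ o ∧ Conn ends x a₁ b ∧
        Conn ends x a₂ a₃ ∧ ¬ Conn ends x a₂ o ∧ ¬ Conn ends x a₂ b ∧ ¬ Conn ends x a₁ a₃) := by
      by_contra hno
      push Not at hno
      exact h ⟨hc, fun h1 => h1.2.2.2.2.2 (hno.1 h1.1 h1.2.1 h1.2.2.1 h1.2.2.2.1 h1.2.2.2.2.1),
        fun h2 => h2.2.2.2.2.2 (hno.2 h2.1 h2.2.1 h2.2.2.1 h2.2.2.2.1 h2.2.2.2.2.1)⟩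
    have hq := hc.notQ
    unfold MildSt UncrossedSt st St.q' St.Lo St.Ho St.Lb St.Hb St.L3 St.H3
    rcases h' with ⟨h1, h2, h3, h4, h5, h6⟩ | ⟨h1, h2, h3, h4, h5, h6⟩ <;>
      simp [hq, h1, h2, h3, h4, h5, h6]
  · unfold MildSt
    rw [uncrossedSt_st ends o a₁ a₂ a₃ b hc]
    simp

/-- **Row 2′TRI on every mild instance**: the crossings «`o, b` at one root, `a₃` alone at the
other» are harmless; every other crossing is excluded. -/
theorem typedCount_nonneg_of_mild (F : Finset E) (z : Config E) (τ : E → ℕ)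
    (hτ : ∀ e ∈ F, τ e = 1 ∨ τ e = 2) (hM : MildInst ends o a₁ a₂ a₃ b F z) :
    0 ≤ typedCount F z τ (K3 ends o a₁ a₂ a₃ b : Config E → Config E → Config E → R) := by
  have h6 := six_mul_typedCount F z τ hτ (K3 ends o a₁ a₂ a₃ b : Config E → Config E → Config E → R)
  have hK : (0 : R) ≤ typedCount F z τ (fun x y w =>
      ((symK (st ends o a₁ a₂ a₃ b x) (st ends o a₁ a₂ a₃ b y) (st ends o a₁ a₂ a₃ b w) : ℤ) : R)) := by
    refine typedCount_nonneg_of_nonneg_on' F z τ fun x y w hx hy hw => ?_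
    have ux := mildSt_st ends o a₁ a₂ a₃ b (hM.not_bad x (le_zF hx))
    have uy := mildSt_st ends o a₁ a₂ a₃ b (hM.not_bad y (le_zF hy))
    have uw := mildSt_st ends o a₁ a₂ a₃ b (hM.not_bad w (le_zF hw))
    exact_mod_cast symK_nonneg_mild _ _ _ ux (validSt_st ends o a₁ a₂ a₃ b x) uy
      (validSt_st ends o a₁ a₂ a₃ b y) uw (validSt_st ends o a₁ a₂ a₃ b w)
  have hsym : typedCount F z τ (fun x y w =>
      ((symK (st ends o a₁ a₂ a₃ b x) (st ends o a₁ a₂ a₃ b y) (st ends o a₁ a₂ a₃ b w) : ℤ) : R)) =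
      typedCount F z τ (fun x y w =>
        (K3 ends o a₁ a₂ a₃ b x y w : R) + K3 ends o a₁ a₂ a₃ b x w y + K3 ends o a₁ a₂ a₃ b y x w +
          K3 ends o a₁ a₂ a₃ b y w x + K3 ends o a₁ a₂ a₃ b w x y + K3 ends o a₁ a₂ a₃ b w y x) := by
    refine typedCount_congr' _ _ _ _ _ fun x y w => ?_
    simp only [K3_eq_KB]
    unfold symK
    push_cast
    ring
  have h6' : (0 : R) ≤ 6 * typedCount F z τ (K3 ends o a₁ a₂ a₃ b : Config E → Config E → Config E → R) := by
    rw [h6, ← hsym]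
    exact hK
  exact (mul_nonneg_iff_of_pos_left (by norm_num : (0 : R) < 6)).mp h6'

end Sharpened

end RootBridge

end CovForm

end Summit.Ventures.PercRepro2
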